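import Mathlib.CategoryTheory.Preadditive.AdditiveFunctor
import Mathlib.CategoryTheory.Limits.Preserves.Shapes.Products
import Mathlib.CategoryTheory.Limits.Shapes.ZeroObjects
import Mathlib.Algebra.BigOperators.Group.Finset.Basic
import HarnessLib

/-!
# An additive functor preserves coproducts of families with finitely many non-zero members

In a preadditive category a coproduct `∐_j F_j` of a family all of whose members outside a finite set `S` are zero
objects is the finite direct sum `⊕_{j ∈ S} F_j`: the projections `π_j : ∐ F → F_j` (`Sigma.desc` of the Kronecker
deltas) satisfy `∑_{j ∈ S} π_j ≫ ι_j = 𝟙`. Hence every ADDITIVE functor `G` preserves such a coproduct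
(`preservesColimit_discrete_of_isZero_of_notMem`): the cofan `(G(ι_j))_j` on `G(∐ F)` is a colimit, with
`desc t = ∑_{j ∈ S} G(π_j) ≫ t_j` (Weibel, *An introduction to homological algebra*, §2.6: additive functors preserve
finite direct sums — here for a coproduct indexed by an arbitrary type but SUPPORTED on a finite set, the form in which
the terms `∐_{q+i=n} 𝓗om(E^{-i}, L^q)` of the internal Hom complex of a BOUNDED complex `E•` arise).

Everything is proved; no named facts; no definitions. Motivation: the comparison `f_*•𝓗om•(E•, L•) → 𝓗om•(f_*•E•, f_*•L•)`
of the internal Hom complex along a morphism of schemes (`HodgeTheory/HomComplexPushforwardComparison`), where the direct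
image `f_*` is additive but preserves no infinite coproducts.

## References

* C. A. Weibel, *An introduction to homological algebra* (1994), §2.6 (additive functors preserve finite direct sums) and
  §1.2, 1.2.6 (total complexes). [Weibel1994]
-/

noncomputable section

open CategoryTheory CategoryTheory.Limits

universe w v₁ v₂ u₁ u₂

namespace Literature.Algebra.Homology

variable {C : Type u₁} [Category.{v₁} C] [Preadditive C] {D : Type u₂} [Category.{v₂} D] [Preadditive D]
  (G : C ⥤ D) [G.Additive] {J : Type w} (F : J → C) [HasCoproduct F]

/-- **`∑_{j ∈ S} π_j ≫ ι_j = 𝟙_{∐ F}`** for a coproduct supported on the finite set `S` (the members `F_j`, `j ∉ S`, being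
zero objects), where `π_j = Sigma.desc (δ_{·j})` is the projection onto the `j`-th summand.
[cite: Weibel1994, §2.6 (additive categories: finite coproducts are biproducts)] -/
theorem sum_desc_dite_comp_ι_eq_id [DecidableEq J] (S : Finset J) (hS : ∀ j, j ∉ S → IsZero (F j)) :
    (∑ j ∈ S, Sigma.desc (fun k => if h : k = j then eqToHom (congrArg F h) else 0) ≫ Sigma.ι F j) = 𝟙 (∐ F) := by
  apply Sigma.hom_ext
  intro k
  rw [Preadditive.comp_sum, Category.comp_id]
  by_cases hk : k ∈ S
  · rw [Finset.sum_eq_single_of_mem k hk]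
    · rw [Sigma.ι_desc_assoc, dif_pos rfl, eqToHom_refl, Category.id_comp]
    · intro j _ hjk
      rw [Sigma.ι_desc_assoc, dif_neg (Ne.symm hjk), zero_comp]
  · exact (hS k hk).eq_of_src _ _

/-- **An additive functor preserves the coproduct of a family supported on a finite set**: if `F_j` is a zero object for
every `j` outside a finite set `S`, then `G(∐_j F_j)` with the maps `G(ι_j)` is a coproduct of the `G(F_j)` (descend with
`∑_{j ∈ S} G(π_j) ≫ t_j`). [cite: Weibel1994, §2.6 (additive functors preserve finite direct sums)] -/
theorem preservesColimit_discrete_of_isZero_of_notMem (S : Finset J) (hS : ∀ j, j ∉ S → IsZero (F j)) :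
    PreservesColimit (Discrete.functor F) G := by
  classical
  let π : ∀ j, ∐ F ⟶ F j := fun j => Sigma.desc (fun k => if h : k = j then eqToHom (congrArg F h) else 0)
  have hιπ : ∀ k j, Sigma.ι F k ≫ π j = if h : k = j then eqToHom (congrArg F h) else 0 := fun k j =>
    Sigma.ι_desc _ _
  have hsum : (∑ j ∈ S, π j ≫ Sigma.ι F j) = 𝟙 (∐ F) := sum_desc_dite_comp_ι_eq_id F S hS
  apply preservesColimit_of_preserves_colimit_cocone (coproductIsCoproduct F)
  refine (isColimitMapCoconeCofanMkEquiv G F (Sigma.ι F)).symm (Cofan.IsColimit.mk _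
    (fun t => ∑ j ∈ S, G.map (π j) ≫ t.inj j) (fun t k => ?_) (fun t m hm => ?_))
  · change G.map (Sigma.ι F k) ≫ ∑ j ∈ S, G.map (π j) ≫ t.inj j = t.inj k
    by_cases hk : k ∈ S
    · rw [Preadditive.comp_sum, Finset.sum_eq_single_of_mem k hk]
      · rw [← G.map_comp_assoc, hιπ, dif_pos rfl, eqToHom_refl, G.map_id, Category.id_comp]
      · intro j _ hjk
        rw [← G.map_comp_assoc, hιπ, dif_neg (Ne.symm hjk), G.map_zero, zero_comp]
    · exact (G.map_isZero (hS k hk)).eq_of_src _ _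
  · change ∀ j, G.map (Sigma.ι F j) ≫ m = t.inj j at hm
    change m = ∑ j ∈ S, G.map (π j) ≫ t.inj j
    have h1 : m = G.map (𝟙 (∐ F)) ≫ m := by rw [G.map_id, Category.id_comp]
    rw [h1, ← hsum, G.map_sum, Preadditive.sum_comp]
    refine Finset.sum_congr rfl fun j _ => ?_
    rw [G.map_comp, Category.assoc, hm j]

end Literature.Algebra.Homology

end
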